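import Summits.RiemannHypothesis.RiemannHypothesis.Theorems.WeilGroundStateGroundStatesConvergeToXiDoobIdentity
import Summits.RiemannHypothesis.RiemannHypothesis.Theorems.WeilGroundStateGroundStatesConvergeToXiEnergyUpperTail
import Summits.RiemannHypothesis.RiemannHypothesis.Theorems.GroundStatesConvergeToXi.Negative.NotAttained
import Literature.NumberTheory.LFunctions.WeilExplicit
import HarnessLib

/-!
# `WeilGroundState.GroundStatesConvergeToXi` — the ground energy `ε(a)` in Doob variables
(crux item stmt-RiemannHypothesis-1527, route route-RiemannHypothesis-WeilGroundState; line `Sketch`,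
stub `stub_weilGroundEnergy_doob` (G1); `--supports`; RH-free)

Riemann's kernel `Φ(t) = 2Ψ(2t)` is smooth (`contDiff_phi`) and strictly positive on `ℝ`
(`Negative.Psi_pos_of_nonneg` and the evenness `LagariasMontague.Psi_neg`), so `g ↦ w = g / Φ`
is a bijection of the Weil test functions supported in the window `[-a, a]` onto themselves, with
`∫ ‖g‖² = ∫ Φ² ‖w‖²` and, by the landed Doob identity `doob_identity`,
`Re Q(g) = Re Q(Φ w) = Σ_n Λ(n) n^{-1/2} I_w(log n) + ∫₀^∞ e^{h/2}/(2 sinh h) I_w − ∫₀^∞ 2cosh(h/2) I_w`,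
`I_w(h) = ∫ Φ(t) Φ(t + h) ‖w(t + h) − w(t)‖² dt`.  Hence the set whose infimum is the ground energy
`ε(a) = weilGroundEnergy a` and the set of values of the Doob form on the `Φ`-weighted unit sphere
of the window coincide (`geDoob_set_eq`), and so do their infima (`stub_weilGroundEnergy_doob`).

No new definitions.
-/

noncomputable section

set_option linter.dupNamespace false

open scoped Topology Real ComplexConjugate ArithmeticFunction.vonMangoldt
open Filter Set MeasureTheory Complex

namespace Summit.RiemannHypothesis.RiemannHypothesis.Theorems.GroundStatesConvergeToXi

open Literature.NumberTheory.LFunctions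

/-! ## `Φ` is a smooth unit: division by `Φ` preserves test functions -/

/-- `Ψ > 0` on all of `ℝ`: positive on `[0, ∞)` (`Negative.Psi_pos_of_nonneg`) and even
(`LagariasMontague.Psi_neg`). [folklore] -/
theorem geDoob_Psi_pos (x : ℝ) : 0 < LagariasMontague.Psi x := by
  rcases le_or_gt 0 x with hx | hx
  · exact Negative.Psi_pos_of_nonneg hx
  · rw [← LagariasMontague.Psi_neg]
    exact Negative.Psi_pos_of_nonneg (by linarith)

/-- `Φ(t) = 2Ψ(2t) ≠ 0` in complex form. [folklore] -/
theorem geDoob_phic_ne_zero (t : ℝ) : (2 : ℂ) * LagariasMontague.Psic (2 * t) ≠ 0 := by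
  rw [doobP_phic, Complex.ofReal_ne_zero]
  exact (mul_pos two_pos (geDoob_Psi_pos _)).ne'

/-- `‖Φ(t) z‖² = Φ(t)² ‖z‖²`. [folklore] -/
theorem geDoob_norm_phi_mul_sq (t : ℝ) (z : ℂ) :
    ‖(2 : ℂ) * LagariasMontague.Psic (2 * t) * z‖ ^ 2 =
      (2 * LagariasMontague.Psi (2 * t)) ^ 2 * ‖z‖ ^ 2 := by
  rw [norm_mul, norm_phi, abs_of_pos (geDoob_Psi_pos _), mul_pow]

/-- `Φ(t) · (z / Φ(t)) = z` (division written as multiplication by the inverse). [folklore] -/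
theorem geDoob_phi_mul_mul_inv (t : ℝ) (z : ℂ) :
    (2 : ℂ) * LagariasMontague.Psic (2 * t) * (z * ((2 : ℂ) * LagariasMontague.Psic (2 * t))⁻¹) =
      z := by
  rw [mul_left_comm, mul_inv_cancel₀ (geDoob_phic_ne_zero t), mul_one]

/-- Dividing a test function by `Φ`: `w = g / Φ` is again a Weil test function (`Φ` is smooth,
`contDiff_phi`, and nowhere zero). [folklore] -/
theorem geDoob_isWeilTest_mul_inv {g : ℝ → ℂ} (hg : IsWeilTest g) :
    IsWeilTest (fun t : ℝ => g t * ((2 : ℂ) * LagariasMontague.Psic (2 * t))⁻¹) :=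
  ⟨hg.1.mul (contDiff_phi.inv geDoob_phic_ne_zero), hg.2.mul_right⟩

/-! ## The window sphere in Doob variables -/

/-- **The window problem in Doob variables (set form).**  The set of values `Re Q(g)` over the
window's normalised test functions `g` (`tsupport g ⊆ [-a, a]`, `∫ ‖g‖² = 1`) equals the set of
values of the Doob form over the window's test functions `w` with `∫ Φ² ‖w‖² = 1`: the two are
matched by `g = Φ w`, `w = g / Φ`, and `Re Q(Φ w)` is the Doob form by `doob_identity`.
[folklore] -/
theorem geDoob_set_eq (a : ℝ) :
    {x : ℝ | ∃ g : ℝ → ℂ, IsWeilTest g ∧ tsupport g ⊆ Icc (-a) a ∧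
      ∫ t : ℝ, ‖g t‖ ^ 2 = 1 ∧ x = (weilQuadratic g).re} =
    {x : ℝ | ∃ w : ℝ → ℂ, IsWeilTest w ∧ tsupport w ⊆ Icc (-a) a ∧
        (∫ t : ℝ, (2 * LagariasMontague.Psi (2 * t)) ^ 2 * ‖w t‖ ^ 2 = 1) ∧
        x = (∑' n : ℕ, (Λ n : ℝ) / Real.sqrt n *
              ∫ t : ℝ, 2 * LagariasMontague.Psi (2 * t) * (2 * LagariasMontague.Psi (2 * (t + Real.log n))) *
                ‖w (t + Real.log n) - w t‖ ^ 2) +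
            (∫ h in Ioi (0 : ℝ), Real.exp (h / 2) / (2 * Real.sinh h) *
              ∫ t : ℝ, 2 * LagariasMontague.Psi (2 * t) * (2 * LagariasMontague.Psi (2 * (t + h))) *
                ‖w (t + h) - w t‖ ^ 2) -
            (∫ h in Ioi (0 : ℝ), 2 * Real.cosh (h / 2) *
              ∫ t : ℝ, 2 * LagariasMontague.Psi (2 * t) * (2 * LagariasMontague.Psi (2 * (t + h))) *
                ‖w (t + h) - w t‖ ^ 2)} := by
  ext x
  constructor
  · rintro ⟨g, hg, hsupp, hnorm, hx⟩
    -- `w = g / Φ`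
    obtain ⟨w, hw_def⟩ : ∃ w : ℝ → ℂ,
        w = fun t : ℝ => g t * ((2 : ℂ) * LagariasMontague.Psic (2 * t))⁻¹ := ⟨_, rfl⟩
    have hw : IsWeilTest w := by
      rw [hw_def]
      exact geDoob_isWeilTest_mul_inv hg
    have hgw_pt : ∀ t : ℝ, (2 : ℂ) * LagariasMontague.Psic (2 * t) * w t = g t := fun t => by
      rw [hw_def]
      exact geDoob_phi_mul_mul_inv t (g t)
    have hgw : (fun t : ℝ => (2 : ℂ) * LagariasMontague.Psic (2 * t) * w t) = g := funext hgw_pt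
    refine ⟨w, hw, ?_, ?_, ?_⟩
    · refine Subset.trans ?_ hsupp
      rw [hw_def]
      exact tsupport_mul_subset_left
    · rw [← hnorm]
      refine integral_congr_ae (ae_of_all _ fun t => ?_)
      beta_reduce
      rw [← hgw_pt t, geDoob_norm_phi_mul_sq]
    · rw [hx, ← hgw]
      exact doob_identity hw
  · rintro ⟨w, hw, hsupp, hnorm, hx⟩
    -- `g = Φ w`
    refine ⟨fun t : ℝ => (2 : ℂ) * LagariasMontague.Psic (2 * t) * w t,
      ⟨contDiff_phi.mul hw.1, hw.2.mul_left⟩, tsupport_mul_subset_right.trans hsupp, ?_, ?_⟩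
    · rw [← hnorm]
      exact integral_congr_ae (ae_of_all _ fun t => geDoob_norm_phi_mul_sq t (w t))
    · rw [hx]
      exact (doob_identity hw).symm

/-! ## The registered stub -/

/-- **Stub G1 — `weilGroundEnergy_doob` (RH-free).**  The ground energy in Doob variables: since
`g ↦ w = g/Φ` is a bijection of the window's test functions (`Φ` smooth and `> 0`) with
`∫‖g‖² = ∫ Φ²‖w‖²` and `Re Q(Φw)` = the Doob form (`doob_identity`),
`ε(a) = inf { Σ_n Λ(n)n^{-1/2} I_w(log n) + ∫₀^∞ (e^{h/2}/(2 sinh h)) I_w − ∫₀^∞ 2cosh(h/2) I_w :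
  w test, tsupport w ⊆ [−a,a], ∫ Φ²‖w‖² = 1 }` (`geDoob_set_eq` under `sInf`; the hypothesis
`0 < a` is not needed). [folklore] -/
theorem stub_weilGroundEnergy_doob :
    ∀ a : ℝ, 0 < a →
      weilGroundEnergy a = sInf {x : ℝ | ∃ w : ℝ → ℂ, IsWeilTest w ∧ tsupport w ⊆ Icc (-a) a ∧
        (∫ t : ℝ, (2 * LagariasMontague.Psi (2 * t)) ^ 2 * ‖w t‖ ^ 2 = 1) ∧
        x = (∑' n : ℕ, (Λ n : ℝ) / Real.sqrt n *
              ∫ t : ℝ, 2 * LagariasMontague.Psi (2 * t) * (2 * LagariasMontague.Psi (2 * (t + Real.log n))) *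
                ‖w (t + Real.log n) - w t‖ ^ 2) +
            (∫ h in Ioi (0 : ℝ), Real.exp (h / 2) / (2 * Real.sinh h) *
              ∫ t : ℝ, 2 * LagariasMontague.Psi (2 * t) * (2 * LagariasMontague.Psi (2 * (t + h))) *
                ‖w (t + h) - w t‖ ^ 2) -
            (∫ h in Ioi (0 : ℝ), 2 * Real.cosh (h / 2) *
              ∫ t : ℝ, 2 * LagariasMontague.Psi (2 * t) * (2 * LagariasMontague.Psi (2 * (t + h))) *
                ‖w (t + h) - w t‖ ^ 2)} := by
  intro a _
  exact congrArg sInf (geDoob_set_eq a)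

end Summit.RiemannHypothesis.RiemannHypothesis.Theorems.GroundStatesConvergeToXi
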